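import Literature.Analysis.UnboundedOperators.SemilinearMildGluing
import HarnessLib

/-!
# The linear mild (Volterra) equation: Lipschitz dependence on the datum and uniqueness of continuous solutions

Analysis/UnboundedOperators support file (everything proved; no definitions, no named facts), the LINEAR
companion of `SemilinearMildGluing.lean` (`mild_unique`) and `SemilinearMildTubeLipschitz.lean`
(`exists_forall_norm_sub_le_of_mild`).  Let `E` be a real Banach space, `T(t)` contractions (`t ≥ 0`),
`K(t)` bounded operators strongly continuous on `(0, ∞)` with the weakly singular bound `‖K(t)‖ ≤ C t^{−α}`
(`C ≥ 0`, `α < 1`), and `B : ℝ → L(E)` a family of bounded COEFFICIENT operators with `‖B(s)‖ ≤ β` on the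
time interval.  A curve `z`, continuous on `[0, L']`, is a solution of the linear mild equation from the
datum `x` when

  `z(t) = T(t) x − ∫₀ᵗ K(t − s) B(s) z(s) ds`     (`0 ≤ t ≤ L'`).

This is the equation of the derivative of the semilinear mild flow along a solution `y`
(`B(s) = N(y(s), ·) + N(·, y(s))`; D. Henry, *Geometric Theory of Semilinear Parabolic Equations*,
LNM 840 (1981), Cor. 3.4.6, Lemma 7.1.1) and of `Literature.Analysis.UnboundedOperators.exists_linearMildFlow`
(`LinearMildFlow.lean`, whose uniqueness clause needs NORM continuity of `T`, `K`, `B`; here only strong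
continuity of `K` and continuity of the composite sources `s ↦ B(s) z(s)` are used):

* `exists_forall_norm_sub_le_of_linearMild` — **Lipschitz dependence on the datum, uniformly in the
  horizon `L' ≤ L` and in the coefficient family**: `‖z(t) − z'(t)‖ ≤ Lip ‖x − x'‖` on `[0, L']` for solutions
  `z`, `z'` from `x`, `x'` (the singular Grönwall lemma `Literature.Analysis.ODE.singular_gronwall_uniform`);
* `linearMild_unique` — two solutions from the same datum, continuous on `[0, L']`, coincide there.

Deliberately NOT here: existence (see `exists_linearMildFlow`), dependence on `B`.

## References

* D. Henry, *Geometric Theory of Semilinear Parabolic Equations*, LNM 840, Springer (1981), Lemma 7.1.1,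
  Thm. 3.3.3, Cor. 3.4.6. [Henry1981]
* A. Pazy, *Semigroups of Linear Operators and Applications to Partial Differential Equations*, Springer
  (1983), §6.3, Thm. 6.3.1. [Pazy1983]
-/

noncomputable section

open Set Filter MeasureTheory intervalIntegral
open _root_.Topology

namespace Literature.Analysis.UnboundedOperators

variable {E : Type*} [NormedAddCommGroup E] [NormedSpace ℝ E]

omit [NormedSpace ℝ E] in
/-- A function continuous on `[0, L']` agrees on `[0, L']` with a function continuous on `ℝ` (the
extension `Set.IccExtend` by constants; for `L' < 0` there is nothing to prove). [folklore] -/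
theorem exists_continuous_eqOn_Icc {g : ℝ → E} {L' : ℝ} (hg : ContinuousOn g (Icc 0 L')) :
    ∃ g' : ℝ → E, Continuous g' ∧ EqOn g' g (Icc 0 L') := by
  rcases lt_or_ge L' 0 with hL' | hL'
  · exact ⟨fun _ => 0, continuous_const, fun s hs => (not_le.2 hL' (hs.1.trans hs.2)).elim⟩
  · exact ⟨IccExtend hL' ((Icc 0 L').restrict g), (continuousOn_iff_continuous_restrict.1 hg).Icc_extend',
      fun s hs => IccExtend_of_mem hL' _ hs⟩

/-- **Lipschitz dependence on the datum for the linear mild equation, uniformly in the horizon and in the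
coefficients** (Henry 1981, Lemma 7.1.1; Pazy 1983, Thm. 6.3.1).  Let `T(t)` be contractions (`t ≥ 0`),
`K(t)` strongly continuous on `(0, ∞)` with `‖K(t)‖ ≤ C t^{−α}` (`C ≥ 0`, `α < 1`), and `β`, `L` reals.
There is `Lip ≥ 1` such that for every `L' ≤ L`, every coefficient family `B` with `‖B(s)‖ ≤ β` on `[0, L']`
and all `z, z'` continuous on `[0, L']` with continuous sources `s ↦ B(s) z(s)`, `s ↦ B(s) z'(s)` there,
solving `z(t) = T(t) x − ∫₀ᵗ K(t − s) B(s) z(s) ds`, `z'(t) = T(t) x' − ∫₀ᵗ K(t − s) B(s) z'(s) ds` on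
`[0, L']`, one has `‖z(t) − z'(t)‖ ≤ Lip ‖x − x'‖` for all `t ∈ [0, L']`: the difference `d = ‖z − z'‖`
satisfies `d(t) ≤ ‖x − x'‖ + C β ∫₀ᵗ (t − s)^{−α} d(s) ds`, and the singular Grönwall lemma applies.
[cite: Henry1981, Lemma 7.1.1] -/
theorem exists_forall_norm_sub_le_of_linearMild (T K : ℝ → E →L[ℝ] E) (hTnorm : ∀ t, 0 ≤ t → ‖T t‖ ≤ 1)
    {α C : ℝ} (hα : α < 1) (hC : 0 ≤ C) (hK : ∀ t, 0 < t → ‖K t‖ ≤ C * t ^ (-α))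
    (hKc : ∀ y : E, ContinuousOn (fun t : ℝ => K t y) (Ioi 0)) (β L : ℝ) :
    ∃ Lip : ℝ, 1 ≤ Lip ∧ ∀ L' ≤ L, ∀ (B : ℝ → E →L[ℝ] E) (z z' : ℝ → E) (x x' : E),
      (∀ s ∈ Icc 0 L', ‖B s‖ ≤ β) → ContinuousOn z (Icc 0 L') → ContinuousOn z' (Icc 0 L') →
      ContinuousOn (fun s => B s (z s)) (Icc 0 L') → ContinuousOn (fun s => B s (z' s)) (Icc 0 L') →
      (∀ t ∈ Icc 0 L', z t = T t x - ∫ s in (0 : ℝ)..t, K (t - s) (B s (z s))) →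
      (∀ t ∈ Icc 0 L', z' t = T t x' - ∫ s in (0 : ℝ)..t, K (t - s) (B s (z' s))) →
      ∀ t ∈ Icc 0 L', ‖z t - z' t‖ ≤ Lip * ‖x - x'‖ := by
  obtain ⟨Cg, hCg1, hCg⟩ := Literature.Analysis.ODE.singular_gronwall_uniform hα (C * max β 0) L
  refine ⟨Cg, hCg1, fun L' hL' B z z' x x' hB hz hz' hg hg' hZ hZ' t ht => ?_⟩
  -- continuous extensions of the two sources and of the two curves off `[0, L']`
  obtain ⟨g, hgc, hge⟩ := exists_continuous_eqOn_Icc hg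
  obtain ⟨g', hg'c, hg'e⟩ := exists_continuous_eqOn_Icc hg'
  obtain ⟨w, hwc, hwe⟩ := exists_continuous_eqOn_Icc hz
  obtain ⟨w', hw'c, hw'e⟩ := exists_continuous_eqOn_Icc hz'
  set d : ℝ → ℝ := fun s => ‖w s - w' s‖ with hd
  have hdc : Continuous d := (hwc.sub hw'c).norm
  have hdt : d t = ‖z t - z' t‖ := by simp only [hd, hwe ht, hw'e ht]
  rw [← hdt]
  refine hCg L' hL' ‖x - x'‖ d hdc.continuousOn (fun s _ => norm_nonneg _) (fun s hs => ?_) t ht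
  -- the integral inequality for `d` at `s ∈ [0, L']`
  have hsub : Icc 0 s ⊆ Icc 0 L' := Icc_subset_Icc_right hs.2
  have hdiffg : Continuous fun r => g r - g' r := hgc.sub hg'c
  have hIg : IntervalIntegrable (fun r => K (s - r) (B r (z r))) volume 0 s :=
    (intervalIntegrable_duhamelIntegrand hK hKc hα hgc hs.1).congr fun r hr => by
      rw [uIoc_of_le hs.1] at hr
      simp only [hge (hsub (Ioc_subset_Icc_self hr))]
  have hIg' : IntervalIntegrable (fun r => K (s - r) (B r (z' r))) volume 0 s :=
    (intervalIntegrable_duhamelIntegrand hK hKc hα hg'c hs.1).congr fun r hr => by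
      rw [uIoc_of_le hs.1] at hr
      simp only [hg'e (hsub (Ioc_subset_Icc_self hr))]
  have hdiff : w s - w' s = T s (x - x') - ∫ r in (0 : ℝ)..s, K (s - r) (g r - g' r) := by
    rw [hwe hs, hw'e hs, hZ s hs, hZ' s hs, map_sub (T s)]
    have hI : ∫ r in (0 : ℝ)..s, K (s - r) (g r - g' r) =
        (∫ r in (0 : ℝ)..s, K (s - r) (B r (z r))) - ∫ r in (0 : ℝ)..s, K (s - r) (B r (z' r)) := by
      rw [← intervalIntegral.integral_sub hIg hIg']
      refine intervalIntegral.integral_congr fun r hr => ?_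
      rw [uIcc_of_le hs.1] at hr
      simp only [map_sub, hge (hsub hr), hg'e (hsub hr)]
    rw [hI]
    abel
  have hpt : ∀ r ∈ Icc 0 s, ‖g r - g' r‖ ≤ max β 0 * d r := by
    intro r hr
    have hr' : r ∈ Icc 0 L' := hsub hr
    simp only [hd, hge hr', hg'e hr', hwe hr', hw'e hr', ← map_sub]
    exact (B r).le_of_opNorm_le ((hB r hr').trans (le_max_left _ _)) _
  calc d s = ‖w s - w' s‖ := rfl
    _ ≤ ‖T s (x - x')‖ + ‖∫ r in (0 : ℝ)..s, K (s - r) (g r - g' r)‖ := by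
        rw [hdiff]; exact norm_sub_le _ _
    _ ≤ ‖x - x'‖ + C * ∫ r in (0 : ℝ)..s, (s - r) ^ (-α) * ‖g r - g' r‖ := by
        gcongr
        · calc ‖T s (x - x')‖ ≤ ‖T s‖ * ‖x - x'‖ := (T s).le_opNorm _
            _ ≤ 1 * ‖x - x'‖ := by gcongr; exact hTnorm s hs.1
            _ = ‖x - x'‖ := one_mul _
        · exact norm_integral_weaklySingular_le hα hK hdiffg hs.1
    _ ≤ ‖x - x'‖ + C * ∫ r in (0 : ℝ)..s, (s - r) ^ (-α) * (max β 0 * d r) := by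
        gcongr ‖x - x'‖ + C * ?_
        refine intervalIntegral.integral_mono_on hs.1 ?_ ?_ fun r hr => ?_
        · exact Literature.Analysis.ODE.intervalIntegrable_sub_rpow_neg_mul hα s hdiffg.norm.continuousOn
        · exact Literature.Analysis.ODE.intervalIntegrable_sub_rpow_neg_mul hα s
            ((continuous_const.mul hdc).continuousOn)
        · exact mul_le_mul_of_nonneg_left (hpt r hr) (Real.rpow_nonneg (sub_nonneg.2 hr.2) _)
    _ = ‖x - x'‖ + (C * max β 0) * ∫ r in (0 : ℝ)..s, (s - r) ^ (-α) * d r := by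
        rw [mul_assoc C, ← intervalIntegral.integral_const_mul (max β 0)]
        congr 2
        refine intervalIntegral.integral_congr fun r _ => ?_
        ring

/-- **Uniqueness of continuous solutions of the linear mild equation** (Henry 1981, Lemma 7.1.1 /
Thm. 3.3.3): for contractions `T(t)`, a weakly singular strongly continuous family `K` and bounded
coefficients `B`, two solutions of `z(t) = T(t) x − ∫₀ᵗ K(t − s) B(s) z(s) ds` from the same datum that are
continuous on `[0, L']` together with their sources `s ↦ B(s) z(s)` coincide on `[0, L']` — the Lipschitz
estimate `exists_forall_norm_sub_le_of_linearMild` with equal data. [cite: Henry1981, Lemma 7.1.1] -/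
theorem linearMild_unique (T K : ℝ → E →L[ℝ] E) (hTnorm : ∀ t, 0 ≤ t → ‖T t‖ ≤ 1)
    {α C : ℝ} (hα : α < 1) (hC : 0 ≤ C) (hK : ∀ t, 0 < t → ‖K t‖ ≤ C * t ^ (-α))
    (hKc : ∀ y : E, ContinuousOn (fun t : ℝ => K t y) (Ioi 0)) {L' β : ℝ} (B : ℝ → E →L[ℝ] E)
    (hB : ∀ s ∈ Icc 0 L', ‖B s‖ ≤ β) {x : E} {z z' : ℝ → E} (hz : ContinuousOn z (Icc 0 L'))
    (hz' : ContinuousOn z' (Icc 0 L')) (hg : ContinuousOn (fun s => B s (z s)) (Icc 0 L'))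
    (hg' : ContinuousOn (fun s => B s (z' s)) (Icc 0 L'))
    (hZ : ∀ t ∈ Icc 0 L', z t = T t x - ∫ s in (0 : ℝ)..t, K (t - s) (B s (z s)))
    (hZ' : ∀ t ∈ Icc 0 L', z' t = T t x - ∫ s in (0 : ℝ)..t, K (t - s) (B s (z' s))) :
    EqOn z z' (Icc 0 L') := by
  obtain ⟨Lip, -, hLip⟩ := exists_forall_norm_sub_le_of_linearMild T K hTnorm hα hC hK hKc β L'
  intro t ht
  have h := hLip L' le_rfl B z z' x x hB hz hz' hg hg' hZ hZ' t ht
  rwa [sub_self, norm_zero, mul_zero, norm_le_zero_iff, sub_eq_zero] at h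

end Literature.Analysis.UnboundedOperators

end
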